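import Mathlib
import Literature.Analysis.SpecialFunctions.LegendrePolynomials
import HarnessLib

/-!
# Monomials in the Legendre basis: `x^n = Σ_l a(n,l) P_l(x)` with explicit coefficients

RH-free helper for the GroundBarta block certificates (`--supports` the parity ladder item): the inverse change of basis
`D = C⁻¹` of a `WeilCert` (`C` = coefficients of the Legendre polynomials `P_{2i+p}` in the powers `y^{2k+p}`) has the
CLOSED FORM `D_{ki} = a(2k+p, 2i+p)`,
  `a(n,l) = (2l+1) 2^l n! ((n+l)/2)! / (((n−l)/2)! (n+l+1)!)`   (`l ≤ n`, `n ≡ l (mod 2)`; else `0`),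
the Fourier–Legendre coefficients of `x^n`.  This file proves it:

* `integral_pow_mul_one_sub_sq_pow` — `∫_{-1}^{1} x^{2r}(1−x²)^m dx = 2^{2m+1} m! (2r)! (r+m)! / (r! (2r+2m+1)!)` (parts);
* `integral_pow_mul_legendre` — `∫_{-1}^{1} x^n P_m(x) dx` in closed form for `m ≤ n` (Rodrigues + parts), `0` for the wrong parity;
* `eq_zero_of_orthogonal_legendre` — a polynomial of degree `≤ n` orthogonal to `P_0, …, P_n` vanishes;
* `X_pow_eq_sum_legendre` — `X^{2i+p} = Σ_{k<N} a(2i+p, 2k+p) • P_{2k+p}` (`i < N`, `p ≤ 1`);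
* `sum_legendreInvCoeff_mul_coeff` — `Σ_{k<N} a(2i+p,2k+p) · coeff_{2j+p}(P_{2k+p}) = [i = j]`, i.e. `D C = I` entrywise.

The sequel `WeilBlockLegendreInverseTable.lean` turns this into kernel-cheap tables and the `WeilCert.checkDCRow` /
`checkDnRow` facts, so that a certificate with `DE/DO := legendreInvTable` needs no `D` data and no `D C = I` row files.

References: Fourier–Legendre expansion of monomials [folklore]; Rodrigues' formula [cite: AndrewsAskeyRoy1999, (2.5.13')].
-/

set_option linter.dupNamespace false

open Polynomial Finset MeasureTheory intervalIntegral
open scoped Nat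

namespace Summit.RiemannHypothesis.RiemannHypothesis.Theorems.LegendreInverse

open Literature.Analysis.SpecialFunctions

/-! ## `∫_{-1}^{1} x^{2r} (1 − x²)^m dx` -/

/-- The closed form `V(r,m) = 2^{2m+1} m! (2r)! (r+m)! / (r! (2r+2m+1)!)`. [folklore] -/
noncomputable def wallisV (r m : ℕ) : ℝ :=
  2 ^ (2 * m + 1) * (m ! : ℝ) * ((2 * r)! : ℝ) * ((r + m)! : ℝ) / ((r ! : ℝ) * ((2 * r + 2 * m + 1)! : ℝ))

/-- Base case `∫ (1 − x²)^m = 2^{2m+1} (m!)² / (2m+1)!`. [folklore] -/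
theorem integral_one_sub_sq_pow_eq_wallisV (m : ℕ) :
    ∫ x in (-1 : ℝ)..1, x ^ (2 * 0) * (1 - x ^ 2) ^ m = wallisV 0 m := by
  simp only [mul_zero, pow_zero, one_mul]
  rw [integral_one_sub_sq_pow]
  have h := factorial_mul_wallis_prod m
  have hf : ((2 * m + 1)! : ℝ) ≠ 0 := by positivity
  have hprod : ∏ i ∈ range m, (2 * (i : ℝ) + 2) / (2 * i + 3) = 4 ^ m * (m ! : ℝ) ^ 2 / ((2 * m + 1)! : ℝ) := by
    rw [eq_div_iff hf, mul_comm]; exact h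
  rw [hprod, wallisV]
  have h4 : (4 : ℝ) ^ m = 2 ^ (2 * m) := by rw [pow_mul]; norm_num
  simp only [Nat.factorial_zero, Nat.cast_one, mul_zero, zero_add, one_mul]
  rw [h4, pow_succ]
  field_simp
  ring

/-- One integration by parts: `∫ x^{2r+2}(1−x²)^m = (2r+1)/(2m+2) · ∫ x^{2r}(1−x²)^{m+1}`. [folklore] -/
theorem integral_pow_mul_one_sub_sq_pow_succ (r m : ℕ) :
    ∫ x in (-1 : ℝ)..1, x ^ (2 * (r + 1)) * (1 - x ^ 2) ^ m =
      (2 * (r : ℝ) + 1) / (2 * (m : ℝ) + 2) * ∫ x in (-1 : ℝ)..1, x ^ (2 * r) * (1 - x ^ 2) ^ (m + 1) := by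
  set f : ℝ[X] := C (-(1 / (2 * (m : ℝ) + 2))) * (1 - X ^ 2) ^ (m + 1) with hf
  set g : ℝ[X] := X ^ (2 * r + 1) with hg
  have hm : (2 * (m : ℝ) + 2) ≠ 0 := by positivity
  have hparts := integral_derivative_mul f g
  have h1 : ∀ x : ℝ, (derivative f).eval x * g.eval x = x ^ (2 * (r + 1)) * (1 - x ^ 2) ^ m := by
    intro x
    simp only [hf, hg, derivative_mul, derivative_C, zero_mul, zero_add, derivative_pow, derivative_sub,
      derivative_one, derivative_X, zero_sub, Nat.add_sub_cancel, eval_mul, eval_C, eval_pow, eval_sub,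
      eval_one, eval_X, eval_neg, eval_natCast, map_natCast, mul_one]
    field_simp
    push_cast
    ring
  have h2 : ∀ x : ℝ, f.eval x * (derivative g).eval x =
      -((2 * (r : ℝ) + 1) / (2 * (m : ℝ) + 2)) * (x ^ (2 * r) * (1 - x ^ 2) ^ (m + 1)) := by
    intro x
    simp only [hf, hg, derivative_X_pow, Nat.add_sub_cancel, eval_mul, eval_C, eval_pow, eval_sub, eval_one,
      eval_X, eval_natCast, map_natCast]
    field_simp
    push_cast
    ring
  have hb1 : f.eval 1 = 0 := by simp [hf]
  have hb2 : f.eval (-1) = 0 := by simp [hf]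
  calc ∫ x in (-1 : ℝ)..1, x ^ (2 * (r + 1)) * (1 - x ^ 2) ^ m
      = ∫ x in (-1 : ℝ)..1, (derivative f).eval x * g.eval x := intervalIntegral.integral_congr fun x _ ↦ (h1 x).symm
    _ = f.eval 1 * g.eval 1 - f.eval (-1) * g.eval (-1) - ∫ x in (-1 : ℝ)..1, f.eval x * (derivative g).eval x := hparts
    _ = -∫ x in (-1 : ℝ)..1, -((2 * (r : ℝ) + 1) / (2 * (m : ℝ) + 2)) * (x ^ (2 * r) * (1 - x ^ 2) ^ (m + 1)) := by
        rw [hb1, hb2, zero_mul, zero_mul, sub_zero, zero_sub]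
        exact congrArg Neg.neg (intervalIntegral.integral_congr fun x _ ↦ h2 x)
    _ = (2 * (r : ℝ) + 1) / (2 * (m : ℝ) + 2) * ∫ x in (-1 : ℝ)..1, x ^ (2 * r) * (1 - x ^ 2) ^ (m + 1) := by
        rw [intervalIntegral.integral_const_mul]; ring

/-- **`∫_{-1}^{1} x^{2r} (1 − x²)^m dx = 2^{2m+1} m! (2r)! (r+m)! / (r! (2r+2m+1)!)`.** [folklore] -/
theorem integral_pow_mul_one_sub_sq_pow (r : ℕ) : ∀ m : ℕ,
    ∫ x in (-1 : ℝ)..1, x ^ (2 * r) * (1 - x ^ 2) ^ m = wallisV r m := by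
  induction r with
  | zero => exact integral_one_sub_sq_pow_eq_wallisV
  | succ r ih =>
      intro m
      rw [integral_pow_mul_one_sub_sq_pow_succ, ih (m + 1), wallisV, wallisV]
      have e1 : ((m + 1)! : ℝ) = (m + 1) * (m ! : ℝ) := by
        rw [Nat.factorial_succ]; push_cast; ring
      have e2 : ((2 * (r + 1))! : ℝ) = (2 * r + 2) * (2 * r + 1) * ((2 * r)! : ℝ) := by
        rw [show 2 * (r + 1) = (2 * r + 1) + 1 by ring, Nat.factorial_succ, Nat.factorial_succ]; push_cast; ring
      have e3 : ((r + 1)! : ℝ) = (r + 1) * (r ! : ℝ) := by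
        rw [Nat.factorial_succ]; push_cast; ring
      have e4 : r + (m + 1) = (r + 1) + m := by ring
      have e5 : 2 * r + 2 * (m + 1) + 1 = 2 * (r + 1) + 2 * m + 1 := by ring
      have e6 : (2 : ℝ) ^ (2 * (m + 1) + 1) = 4 * 2 ^ (2 * m + 1) := by
        rw [show 2 * (m + 1) + 1 = (2 * m + 1) + 2 by ring, pow_add]; norm_num; ring
      rw [e1, e2, e3, e4, e5, e6]
      have hr : ((r ! : ℝ)) ≠ 0 := by positivity
      have hF : (((2 * (r + 1) + 2 * m + 1)! : ℕ) : ℝ) ≠ 0 := by positivity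
      field_simp
      ring

/-- The odd companion: `∫_{-1}^{1} x^{2r+1} (1 − x²)^m dx = 0`. [folklore] -/
theorem integral_pow_odd_mul_one_sub_sq_pow (r m : ℕ) :
    ∫ x in (-1 : ℝ)..1, x ^ (2 * r + 1) * (1 - x ^ 2) ^ m = 0 := by
  have h := intervalIntegral.integral_comp_neg (a := (-1 : ℝ)) (b := 1)
    (f := fun x : ℝ ↦ x ^ (2 * r + 1) * (1 - x ^ 2) ^ m)
  simp only [neg_neg] at h
  have hodd : ∀ x : ℝ, (-x) ^ (2 * r + 1) * (1 - (-x) ^ 2) ^ m = -(x ^ (2 * r + 1) * (1 - x ^ 2) ^ m) := by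
    intro x
    rw [Odd.neg_pow ⟨r, rfl⟩, neg_sq]; ring
  simp_rw [hodd, intervalIntegral.integral_neg] at h
  linarith

/-! ## `∫_{-1}^{1} x^n P_m(x) dx` -/

/-- The Fourier–Legendre coefficient of `x^n` along `P_l`, times `‖P_l‖² = 2/(2l+1)` … i.e. the closed form of
`a(n,l) = (2l+1) 2^l n! ((n+l)/2)! / (((n−l)/2)! (n+l+1)!)` (`l ≤ n`, `n + l` even; `0` otherwise). [folklore] -/
def legendreInvCoeffQ (n l : ℕ) : ℚ :=
  if l ≤ n ∧ Even (n + l) then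
    (((2 * l + 1) * 2 ^ l * n ! * ((n + l) / 2)! : ℕ) : ℚ) / ((((n - l) / 2)! * (n + l + 1)! : ℕ) : ℚ)
  else 0

/-- `a(n,l) = 0` for `l > n`. [folklore] -/
theorem legendreInvCoeffQ_eq_zero_of_lt {n l : ℕ} (h : n < l) : legendreInvCoeffQ n l = 0 := by
  unfold legendreInvCoeffQ; rw [if_neg (by omega)]

/-- `a(n,l) = 0` for the wrong parity. [folklore] -/
theorem legendreInvCoeffQ_eq_zero_of_parity {n l : ℕ} (h : ¬ Even (n + l)) : legendreInvCoeffQ n l = 0 := by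
  unfold legendreInvCoeffQ; rw [if_neg (fun hh ↦ h hh.2)]

/-- Reduction of `∫ x^n P_m` to `∫ x^{n−m} (1 − x²)^m` (Rodrigues + `m` integrations by parts). [folklore] -/
theorem integral_pow_mul_legendre_eq (n m : ℕ) :
    ∫ x in (-1 : ℝ)..1, x ^ n * (legendre m).eval x =
      (n.descFactorial m : ℝ) / (2 ^ m * (m ! : ℝ)) * ∫ x in (-1 : ℝ)..1, x ^ (n - m) * (1 - x ^ 2) ^ m := by
  have h := integral_iterate_derivative_legendreW_mul m le_rfl (X ^ n)
  rw [Nat.sub_self, Function.iterate_zero_apply, iterate_derivative_X_pow_eq_C_mul] at h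
  have hW : ∀ x : ℝ, (legendreW m).eval x = (-1) ^ m * (1 - x ^ 2) ^ m := by
    intro x
    simp only [legendreW, eval_pow, eval_sub, eval_X, eval_one]
    rw [← mul_pow]; ring
  have hlhs : ∫ x in (-1 : ℝ)..1, x ^ n * (legendre m).eval x =
      1 / (2 ^ m * (m ! : ℝ)) * ∫ x in (-1 : ℝ)..1, (derivative^[m] (legendreW m)).eval x * (X ^ n : ℝ[X]).eval x := by
    rw [← intervalIntegral.integral_const_mul]
    refine intervalIntegral.integral_congr fun x _ ↦ ?_
    simp only [legendre, eval_mul, eval_C, eval_pow, eval_X]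
    ring
  rw [hlhs, h]
  simp_rw [hW, eval_mul, eval_C, eval_pow, eval_X]
  rw [show ∫ x in (-1 : ℝ)..1, (-1) ^ m * (1 - x ^ 2) ^ m * ((n.descFactorial m : ℝ) * x ^ (n - m)) =
      (-1) ^ m * (n.descFactorial m : ℝ) * ∫ x in (-1 : ℝ)..1, x ^ (n - m) * (1 - x ^ 2) ^ m by
    rw [← intervalIntegral.integral_const_mul]
    refine intervalIntegral.integral_congr fun x _ ↦ ?_; ring]
  have hsq : ((-1 : ℝ) ^ m) * (-1) ^ m = 1 := by rw [← mul_pow]; norm_num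
  field_simp
  linear_combination ((n.descFactorial m : ℝ) * ∫ x in (-1 : ℝ)..1, x ^ (n - m) * (1 - x ^ 2) ^ m) * hsq

/-- **`∫_{-1}^{1} x^n P_m(x) dx = (2/(2m+1)) · a(n,m)`** for `m ≤ n` (both parities). [folklore] -/
theorem integral_pow_mul_legendre (n m : ℕ) (hm : m ≤ n) :
    ∫ x in (-1 : ℝ)..1, x ^ n * (legendre m).eval x = 2 / (2 * (m : ℝ) + 1) * (legendreInvCoeffQ n m : ℝ) := by
  rw [integral_pow_mul_legendre_eq n m]
  by_cases hp : Even (n + m)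
  · -- `n − m = 2r`, `(n+m)/2 = r + m`
    obtain ⟨s, hs⟩ := hp
    obtain ⟨r, hr⟩ : ∃ r, n = 2 * r + m := ⟨s - m, by omega⟩
    have e1 : n - m = 2 * r := by omega
    have e2 : (n + m) / 2 = r + m := by omega
    have e3 : (n - m) / 2 = r := by omega
    have e4 : n + m + 1 = 2 * r + 2 * m + 1 := by omega
    rw [e1, integral_pow_mul_one_sub_sq_pow, wallisV, legendreInvCoeffQ, if_pos ⟨hm, ⟨s, hs⟩⟩, e2, e3, e4]
    have hdf : (n.descFactorial m : ℝ) * ((2 * r)! : ℝ) = (n ! : ℝ) := by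
      rw [← e1]; exact_mod_cast (by rw [mul_comm]; exact Nat.factorial_mul_descFactorial hm)
    have h2r : ((2 * r)! : ℝ) ≠ 0 := by positivity
    have hdf' : (n.descFactorial m : ℝ) = (n ! : ℝ) / ((2 * r)! : ℝ) := by rw [eq_div_iff h2r, hdf]
    rw [hdf']
    push_cast
    have hr : (r ! : ℝ) ≠ 0 := by positivity
    have hF : ((2 * r + 2 * m + 1)! : ℝ) ≠ 0 := by positivity
    have hm' : (2 * (m : ℝ) + 1) ≠ 0 := by positivity
    field_simp
    ring
  · obtain ⟨r, hr⟩ : ∃ r, n - m = 2 * r + 1 := by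
      rcases Nat.even_or_odd (n - m) with h | h
      · exfalso; apply hp; obtain ⟨s, hs⟩ := h; exact ⟨s + m, by omega⟩
      · obtain ⟨s, hs⟩ := h; exact ⟨s, by omega⟩
    rw [hr, integral_pow_odd_mul_one_sub_sq_pow, legendreInvCoeffQ_eq_zero_of_parity hp]
    simp

/-! ## Expansion of `x^n` in the Legendre basis -/

/-- A polynomial of degree `≤ n` orthogonal to `P_0, …, P_n` on `[-1,1]` vanishes. [folklore] -/
theorem eq_zero_of_orthogonal_legendre (q : ℝ[X]) (n : ℕ) (hq : q.natDegree ≤ n)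
    (h : ∀ m ≤ n, ∫ x in (-1 : ℝ)..1, (legendre m).eval x * q.eval x = 0) : q = 0 := by
  by_contra hq0
  set d := q.natDegree with hd
  set c : ℝ := q.leadingCoeff / legendreLead d with hc
  have hlead : legendreLead d ≠ 0 := (legendreLead_pos d).ne'
  have hc0 : c ≠ 0 := div_ne_zero (leadingCoeff_ne_zero.mpr hq0) hlead
  set r : ℝ[X] := q - C c * legendre d with hr
  -- `deg r < d`
  have hdegP : (C c * legendre d).degree = d := by
    rw [degree_C_mul hc0, degree_eq_natDegree (legendre_ne_zero d), natDegree_legendre]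
  have hdeg : r.degree < d := by
    have hdq : q.degree = (C c * legendre d).degree := by rw [hdegP, degree_eq_natDegree hq0]
    have hlc : q.leadingCoeff = (C c * legendre d).leadingCoeff := by
      rw [leadingCoeff_mul, leadingCoeff_C, leadingCoeff_legendre, hc, div_mul_cancel₀ _ hlead]
    have := degree_sub_lt hdq hq0 hlc
    rwa [degree_eq_natDegree hq0] at this
  -- `∫ P_d q = c ∫ P_d² + ∫ P_d r = c · 2/(2d+1) ≠ 0`
  have hsplit : ∀ x : ℝ, (legendre d).eval x * q.eval x =
      c * (legendre d).eval x ^ 2 + (legendre d).eval x * r.eval x := by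
    intro x; simp only [hr, eval_sub, eval_mul, eval_C]; ring
  have hint := h d hq
  simp_rw [hsplit] at hint
  rw [intervalIntegral.integral_add ((by fun_prop : Continuous _).intervalIntegrable _ _)
      ((by fun_prop : Continuous _).intervalIntegrable _ _), intervalIntegral.integral_const_mul,
    integral_legendre_sq, integral_legendre_mul_eq_zero hdeg, add_zero] at hint
  have : (2 : ℝ) / (2 * d + 1) ≠ 0 := by positivity
  exact hc0 ((mul_eq_zero.1 hint).resolve_right this)

/-- `∫ P_m P_l = [m = l] · 2/(2l+1)`. [folklore] -/
theorem integral_legendre_mul_legendre (m l : ℕ) :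
    ∫ x in (-1 : ℝ)..1, (legendre m).eval x * (legendre l).eval x =
      if m = l then 2 / (2 * (l : ℝ) + 1) else 0 := by
  split_ifs with h
  · subst h; simp_rw [← sq]; exact integral_legendre_sq m
  · rcases lt_or_gt_of_ne h with hlt | hgt
    · rw [← integral_legendre_mul_legendre_eq_zero hlt]
      exact intervalIntegral.integral_congr fun x _ ↦ mul_comm _ _
    · exact integral_legendre_mul_legendre_eq_zero hgt

/-- **Monomials in the Legendre basis (parity-indexed form).** For `p ≤ 1` and `i < N`:
`X^{2i+p} = Σ_{k<N} a(2i+p, 2k+p) • P_{2k+p}`. [folklore] -/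
theorem X_pow_eq_sum_legendre {p : ℕ} (hp : p ≤ 1) {N i : ℕ} (hi : i < N) :
    (X : ℝ[X]) ^ (2 * i + p) =
      ∑ k ∈ range N, C ((legendreInvCoeffQ (2 * i + p) (2 * k + p) : ℚ) : ℝ) * legendre (2 * k + p) := by
  set n := 2 * i + p with hn
  rw [← sub_eq_zero]
  refine eq_zero_of_orthogonal_legendre _ (2 * (N - 1) + p) ?_ ?_
  · -- degree
    refine (natDegree_sub_le _ _).trans (max_le ?_ ?_)
    · rw [natDegree_X_pow]; omega
    · refine natDegree_sum_le_of_forall_le _ _ fun k hk ↦ ?_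
      refine (natDegree_C_mul_le _ _).trans ?_
      rw [natDegree_legendre]
      have := Finset.mem_range.1 hk; omega
  · intro m hmN
    -- `∫ P_m (X^n − Σ) = ∫ x^n P_m − Σ_k a(n,2k+p) ∫ P_m P_{2k+p}`
    have hcont : ∀ k : ℕ, Continuous fun x : ℝ ↦
        (legendre m).eval x * ((((legendreInvCoeffQ n (2 * k + p) : ℚ) : ℝ)) * (legendre (2 * k + p)).eval x) :=
      fun k ↦ by fun_prop
    have hexp : ∀ x : ℝ, (legendre m).eval x * ((X : ℝ[X]) ^ n - ∑ k ∈ range N,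
        C ((legendreInvCoeffQ n (2 * k + p) : ℚ) : ℝ) * legendre (2 * k + p)).eval x =
        x ^ n * (legendre m).eval x - ∑ k ∈ range N,
          (legendre m).eval x * ((((legendreInvCoeffQ n (2 * k + p) : ℚ) : ℝ)) * (legendre (2 * k + p)).eval x) := by
      intro x
      simp only [eval_sub, eval_pow, eval_X, eval_finsetSum, eval_mul, eval_C, mul_sub, Finset.mul_sum]
      ring
    simp_rw [hexp]
    rw [intervalIntegral.integral_sub ((by fun_prop : Continuous _).intervalIntegrable _ _)
        ((continuous_finsetSum _ fun k _ ↦ hcont k).intervalIntegrable _ _),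
      intervalIntegral.integral_finsetSum fun k _ ↦ (hcont k).intervalIntegrable _ _]
    have hterm : ∀ k ∈ range N, ∫ x in (-1 : ℝ)..1,
        (legendre m).eval x * ((((legendreInvCoeffQ n (2 * k + p) : ℚ) : ℝ)) * (legendre (2 * k + p)).eval x) =
        ((legendreInvCoeffQ n (2 * k + p) : ℚ) : ℝ) * (if m = 2 * k + p then 2 / (2 * ((2 * k + p : ℕ) : ℝ) + 1) else 0) := by
      intro k _
      rw [← integral_legendre_mul_legendre, ← intervalIntegral.integral_const_mul]
      exact intervalIntegral.integral_congr fun x _ ↦ by ring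
    rw [Finset.sum_congr rfl hterm]
    -- case analysis on `m` versus `n`
    rcases le_or_gt m n with hmn | hmn
    · rw [integral_pow_mul_legendre n m hmn]
      by_cases hpar : Even (n + m)
      · -- `m = 2k+p` for a unique `k < N`
        obtain ⟨k, hk⟩ : ∃ k, m = 2 * k + p := by
          obtain ⟨s, hs⟩ := hpar; exact ⟨(m - p) / 2, by omega⟩
        have hkN : k ∈ range N := Finset.mem_range.2 (by omega)
        rw [Finset.sum_eq_single_of_mem k hkN (fun l _ hl ↦ by rw [if_neg (by omega), mul_zero]), if_pos hk, hk]
        push_cast; ring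
      · rw [legendreInvCoeffQ_eq_zero_of_parity hpar]
        rw [Finset.sum_eq_zero (fun l _ ↦ by
          rw [if_neg (by rintro rfl; exact hpar ⟨i + l + p, by omega⟩), mul_zero])]
        simp
    · -- `m > n`: orthogonality of `P_m` to `x^n`, and all `a(n, 2k+p)` with `2k+p = m` vanish
      have h0 : ∫ x in (-1 : ℝ)..1, x ^ n * (legendre m).eval x = 0 := by
        have hdeg : ((X : ℝ[X]) ^ n).degree < m := by
          rw [degree_X_pow]; exact_mod_cast hmn
        rw [← integral_legendre_mul_eq_zero hdeg]
        exact intervalIntegral.integral_congr fun x _ ↦ by simp [mul_comm]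
      rw [h0, Finset.sum_eq_zero (fun l _ ↦ ?_), sub_zero]
      split_ifs with hml
      · rw [legendreInvCoeffQ_eq_zero_of_lt (by omega), Rat.cast_zero, zero_mul]
      · rw [mul_zero]

/-- **`D C = I` entrywise**: `Σ_{k<N} a(2i+p, 2k+p) · coeff_{2j+p}(P_{2k+p}) = [i = j]` for `i, j < N`, `p ≤ 1`. [folklore] -/
theorem sum_legendreInvCoeff_mul_coeff {p : ℕ} (hp : p ≤ 1) {N i j : ℕ} (hi : i < N) (hj : j < N) :
    ∑ k ∈ range N, ((legendreInvCoeffQ (2 * i + p) (2 * k + p) : ℚ) : ℝ) * (legendre (2 * k + p)).coeff (2 * j + p) =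
      if i = j then 1 else 0 := by
  have h := congrArg (fun q : ℝ[X] ↦ q.coeff (2 * j + p)) (X_pow_eq_sum_legendre hp hi)
  simp only [coeff_X_pow, finsetSum_coeff, coeff_C_mul] at h
  rw [← h]
  by_cases hij : i = j
  · subst hij; simp
  · rw [if_neg hij, if_neg (by omega)]

end Summit.RiemannHypothesis.RiemannHypothesis.Theorems.LegendreInverse
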